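import Literature.Analysis.FluidPDE.JiaSverak2014EnergyStep
import HarnessLib

/-!
# Jia–Šverák 2014, proof of Thm. 3.1: the decay `E(t) ≲ t^{3/2}` of the local energy of the
  perturbation

Analysis/FluidPDE proofs file (theorems only, no new definitions, no new named facts), part of
the proof of the named fact `Literature.Analysis.FluidPDE.jia_sverak_2014_theorem_3_2`
(`JiaSverak2014LocalRegularity.lean`; H. Jia, V. Šverák, Invent. Math. 196 (2014) =
arXiv:1204.0529, §3 Thm. 3.2). The printed proof of Thm. 3.1 (arXiv p. 8) obtains the smallness
`∫_{B_1(x₀)} |v|²(x,t) + ∫₀ᵗ∫_{B_1(x₀)} |∇v|² ≤ C(α,γ,M) t^{1/30}` of the local energy of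
`v = u - a` and concludes with the perturbed ε-regularity criterion of its §2. The tree has the
*standard* ε-regularity criterion instead (Lemarié-Rieusset 2016, Thm. 13.x/14.4,
`lemarieRieusset_epsilon_regularity_holds`), which at the parabolic scale `√t₀` near the initial
time needs the stronger decay `E(t) ≲ t^{3/2}`; this is obtained here by iterating the step
estimate `energy_step` on the shrinking balls `B_{r_k}(y)`, `r_k = (3/4)·4^{-k}`, `k = 0,…,4`:
with `E_{k+1} ≤ C[(1 + A + C₁A)√t E_k + t^{1/4}E_k^{3/2} + (Aα + α²) t E_k^{1/2}]` the exponents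
improve `0 → 1/4 → 5/8 → 9/8 → 3/2`.

* `exists_cutoff` — the cut-offs `Ψ_k`;
* `ball_bounds_of_tested` — from the tested inequality for a.e. `s` to the energy on the inner
  ball (a.e. `s`) and the dissipation on `(0,t) × B`;
* `iter_bound` — the exponent bookkeeping of one step;
* `decay_iteration` — for parameters `(A, C₁, α, E₀)` there is `Λ` such that, whenever the local
  energy and dissipation of `v` on `(0,t) × B_{3/4}(y)` are `≤ E₀` (`t ≤ min(T', S₀, 1)`), they are
  `≤ Λ t^{3/2}` on `(0,t) × B_{3/1024}(y)`.

## References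

* H. Jia, V. Šverák, Invent. Math. 196 (2014) = arXiv:1204.0529, §3, proof of Thm. 3.1 (p. 8).
  Bib key `JiaSverak2014`.
* P. G. Lemarié-Rieusset, *The Navier–Stokes Problem in the 21st Century* (2016), Prop. 14.1,
  Thm. 14.7. Bib key `LemarieRieusset2016`.
-/

noncomputable section

open MeasureTheory TopologicalSpace Set Function Filter Metric
open _root_.Topology
open scoped ENNReal NNReal RealInnerProductSpace

namespace Literature.Analysis.FluidPDE

namespace JiaSverak2014

/-! ### Cut-offs -/

/-- **A smooth cut-off adapted to two balls**: for `r > 0` there is a smooth `Ψ : ℝ³ → [0,1]`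
with `tsupport Ψ ⊆ B_{r/2}(0)` and `Ψ = 1` on `B_{r/4}(0)` (a `ContDiffBump`). [folklore] -/
theorem exists_cutoff {r : ℝ} (hr : 0 < r) :
    ∃ Ψ : (EuclideanSpace ℝ (Fin 3)) → ℝ, ContDiff ℝ (⊤ : ℕ∞) Ψ ∧ (∀ x, 0 ≤ Ψ x) ∧ (∀ x, Ψ x ≤ 1) ∧
      tsupport Ψ ⊆ ball (0 : EuclideanSpace ℝ (Fin 3)) (r / 2) ∧
      ∀ x ∈ ball (0 : EuclideanSpace ℝ (Fin 3)) (r / 4), Ψ x = 1 := by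
  let θ : ContDiffBump (0 : EuclideanSpace ℝ (Fin 3)) := ⟨r / 4, r / 3, by positivity, by linarith⟩
  have hrIn : θ.rIn = r / 4 := rfl
  have hrOut : θ.rOut = r / 3 := rfl
  refine ⟨θ, θ.contDiff, fun x => θ.nonneg, fun x => θ.le_one, ?_, fun x hx => ?_⟩
  · rw [θ.tsupport_eq, hrOut]
    exact closedBall_subset_ball (by linarith)
  · exact θ.one_of_mem_closedBall (Metric.ball_subset_closedBall (by rwa [hrIn]))

/-! ### Good times are dense -/

/-- If a property holds for a.e. `σ ∈ (0,t)`, then every subinterval `(s,t)`, `0 ≤ s < t`,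
contains a time where it holds. [folklore] -/
theorem exists_mem_Ioo_of_ae {P : ℝ → Prop} {s t : ℝ} (h0 : 0 ≤ s) (hst : s < t)
    (h : ∀ᵐ σ ∂(volume.restrict (Ioo 0 t)), P σ) : ∃ σ ∈ Ioo s t, P σ := by
  by_contra hne
  have h1 : ∀ᵐ σ ∂(volume.restrict (Ioo 0 t)), σ ∉ Ioo s t := h.mono fun σ hσ hmem => hne ⟨σ, hmem, hσ⟩
  have h2 : (volume.restrict (Ioo 0 t)) (Ioo s t) = 0 := measure_eq_zero_iff_ae_notMem.2 h1
  rw [Measure.restrict_apply measurableSet_Ioo, Ioo_inter_Ioo, max_eq_left h0, min_self, Real.volume_Ioo] at h2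
  have : 0 < ENNReal.ofReal (t - s) := ENNReal.ofReal_pos.2 (by linarith)
  exact this.ne' h2

/-! ### From the tested inequality to the energy of the inner ball -/

/-- **From the tested inequality to ball bounds.** Let `Ψ ≥ 0` with `Ψ = 1` on `B_{r'}(0)`, and
suppose that for a.e. `s ∈ (0,t)` the slice `x ↦ |v(s,x)|² Ψ(x - y)` is integrable and
`∫ |v(s)|²Ψ(· - y) + 2∫∫_{(0,s)×ℝ³} d Ψ(· - y) ≤ Φ` (`d ≥ 0`). Then `∫_{B_{r'}(y)} |v(s)|² ≤ Φ` for
a.e. `s ∈ (0,t)` and `∫∫_{(0,t)×B_{r'}(y)} d ≤ Φ` (monotone continuity along good times,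
`setLIntegral_iUnion_of_directed`; in the application `d = |∇v|² ≥ 0`). [folklore] -/
theorem ball_bounds_of_tested {t r' : ℝ} {y : EuclideanSpace ℝ (Fin 3)} {Ψ : (EuclideanSpace ℝ (Fin 3)) → ℝ}
    {v : ℝ → (EuclideanSpace ℝ (Fin 3)) → (EuclideanSpace ℝ (Fin 3))} {d : ℝ × (EuclideanSpace ℝ (Fin 3)) → ℝ} {Φ : ℝ≥0∞}
    (ht : 0 < t) (hΨ0 : ∀ x, 0 ≤ Ψ x) (hΨ1 : ∀ x ∈ ball (0 : EuclideanSpace ℝ (Fin 3)) r', Ψ x = 1)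
    (hint : ∀ᵐ s ∂(volume.restrict (Ioo 0 t)), Integrable (fun x => ‖v s x‖ ^ 2 * Ψ (x - y)) volume)
    (h : ∀ᵐ s ∂(volume.restrict (Ioo 0 t)),
      ENNReal.ofReal (∫ x, ‖v s x‖ ^ 2 * Ψ (x - y)) +
        2 * ∫⁻ z in Ioo 0 s ×ˢ (univ : Set (EuclideanSpace ℝ (Fin 3))), ENNReal.ofReal (d z * Ψ (z.2 - y)) ≤ Φ) :
    (∀ᵐ s ∂(volume.restrict (Ioo 0 t)), ∫⁻ x in ball y r', ‖v s x‖ₑ ^ 2 ≤ Φ) ∧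
      ∫⁻ z in Ioo 0 t ×ˢ ball y r', ENNReal.ofReal (d z) ≤ Φ := by
  have hball : ∀ x ∈ ball y r', Ψ (x - y) = 1 := fun x hx => by
    refine hΨ1 _ ?_
    rw [mem_ball, dist_zero_right]
    rwa [mem_ball, dist_eq_norm] at hx
  constructor
  · filter_upwards [hint, h] with s hs h's
    calc ∫⁻ x in ball y r', ‖v s x‖ₑ ^ 2 = ∫⁻ x in ball y r', ENNReal.ofReal (‖v s x‖ ^ 2 * Ψ (x - y)) := by
          refine setLIntegral_congr_fun measurableSet_ball fun x hx => ?_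
          rw [hball x hx, mul_one, ← ofReal_norm, ENNReal.ofReal_pow (norm_nonneg _)]
      _ ≤ ∫⁻ x, ENNReal.ofReal (‖v s x‖ ^ 2 * Ψ (x - y)) := setLIntegral_le_lintegral _ _
      _ = ENNReal.ofReal (∫ x, ‖v s x‖ ^ 2 * Ψ (x - y)) :=
          (ofReal_integral_eq_lintegral_ofReal hs (Eventually.of_forall fun x => mul_nonneg (sq_nonneg _) (hΨ0 _))).symm
      _ ≤ _ := le_self_add.trans h's
  · -- the dissipation: every `s < t` first, then `s ↑ t`
    have hs_all : ∀ s, s < t → ∫⁻ z in Ioo 0 s ×ˢ ball y r', ENNReal.ofReal (d z) ≤ Φ := by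
      intro s hst
      obtain ⟨σ, hσ, hσP⟩ := exists_mem_Ioo_of_ae (le_max_right s 0) (max_lt hst ht) h
      have hsσ : s < σ := lt_of_le_of_lt (le_max_left _ _) hσ.1
      calc ∫⁻ z in Ioo 0 s ×ˢ ball y r', ENNReal.ofReal (d z)
          ≤ ∫⁻ z in Ioo 0 σ ×ˢ ball y r', ENNReal.ofReal (d z) :=
            lintegral_mono_set (Set.prod_mono (Ioo_subset_Ioo_right hsσ.le) Subset.rfl)
        _ = ∫⁻ z in Ioo 0 σ ×ˢ ball y r', ENNReal.ofReal (d z * Ψ (z.2 - y)) :=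
            setLIntegral_congr_fun (measurableSet_Ioo.prod measurableSet_ball) fun z hz => by rw [hball z.2 hz.2, mul_one]
        _ ≤ ∫⁻ z in Ioo 0 σ ×ˢ (univ : Set (EuclideanSpace ℝ (Fin 3))), ENNReal.ofReal (d z * Ψ (z.2 - y)) :=
            lintegral_mono_set (Set.prod_mono Subset.rfl (subset_univ _))
        _ ≤ 2 * ∫⁻ z in Ioo 0 σ ×ˢ (univ : Set (EuclideanSpace ℝ (Fin 3))), ENNReal.ofReal (d z * Ψ (z.2 - y)) := by
            conv_lhs => rw [← one_mul (∫⁻ z in Ioo 0 σ ×ˢ (univ : Set (EuclideanSpace ℝ (Fin 3))), ENNReal.ofReal (d z * Ψ (z.2 - y)))]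
            exact mul_le_mul' (by norm_num) le_rfl
        _ ≤ Φ := le_add_self.trans hσP
    -- `(0,t) × B = ⋃ₙ (0, t - t/(n+2)) × B`
    set σ : ℕ → ℝ := fun n => t - t / ((n : ℝ) + 2) with hσdef
    have hσlt : ∀ n, σ n < t := fun n => by
      have : 0 < t / ((n : ℝ) + 2) := by positivity
      simp only [hσdef]; linarith
    have hσmono : Monotone σ := by
      intro m n hmn
      simp only [hσdef]
      have h1 : t / ((n : ℝ) + 2) ≤ t / ((m : ℝ) + 2) :=
        div_le_div_of_nonneg_left ht.le (by positivity) (by exact_mod_cast Nat.add_le_add_right hmn 2)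
      linarith
    have hU : (⋃ n, Ioo 0 (σ n) ×ˢ ball y r') = Ioo 0 t ×ˢ ball y r' := by
      refine Subset.antisymm (iUnion_subset fun n => Set.prod_mono (Ioo_subset_Ioo_right (hσlt n).le) Subset.rfl) ?_
      rintro ⟨s, x⟩ ⟨hs, hx⟩
      have hgap : 0 < t - s := by linarith [hs.2]
      obtain ⟨n, hn⟩ := exists_nat_gt (t / (t - s))
      refine mem_iUnion.2 ⟨n, ⟨hs.1, ?_⟩, hx⟩
      simp only [hσdef]
      have h2 : t / ((n : ℝ) + 2) < t - s := by
        rw [div_lt_iff₀ (by positivity)]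
        have h3 : t / (t - s) < (n : ℝ) + 2 := hn.trans (by linarith)
        rw [div_lt_iff₀ hgap] at h3
        linarith
      linarith
    have hdir : Directed (· ⊆ ·) fun n => Ioo 0 (σ n) ×ˢ ball y r' :=
      Monotone.directed_le fun m n hmn => Set.prod_mono (Ioo_subset_Ioo_right (hσmono hmn)) Subset.rfl
    rw [← hU, setLIntegral_iUnion_of_directed _ hdir]
    exact iSup_le fun n => hs_all (σ n) (hσlt n)

/-! ### The exponent bookkeeping -/

/-- **One step of the exponents** (`t ≤ 1`): if `E ≤ M t^e`, then
`P √t E + t^{1/4} E^{3/2} + Q t E^{1/2} ≤ (P M + M^{3/2} + Q M^{1/2}) t^{e'}` for every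
`e' ≤ min(e + 1/2, 1/4 + 3e/2, 1 + e/2)`. [folklore] -/
theorem iter_bound {t e e' : ℝ} (ht : 0 < t) (ht1 : t ≤ 1)
    (he1 : e' ≤ e + 1 / 2) (he2 : e' ≤ 1 / 4 + 3 / 2 * e) (he3 : e' ≤ 1 + e / 2)
    {E M P Q C : ℝ≥0∞} (hE : E ≤ M * ENNReal.ofReal (t ^ e)) :
    C * (P * ENNReal.ofReal (Real.sqrt t) * E + ENNReal.ofReal (t ^ (1 / 4 : ℝ)) * E ^ (3 / 2 : ℝ) +
        Q * ENNReal.ofReal t * E ^ (1 / 2 : ℝ)) ≤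
      C * (P * M + M ^ (3 / 2 : ℝ) + Q * M ^ (1 / 2 : ℝ)) * ENNReal.ofReal (t ^ e') := by
  have hte : 0 ≤ t ^ e := Real.rpow_nonneg ht.le _
  -- powers of `t` dominated by `t^{e'}`
  have hpow : ∀ {f : ℝ}, e' ≤ f → t ^ f ≤ t ^ e' := fun hf => Real.rpow_le_rpow_of_exponent_ge ht ht1 hf
  have h1 : Real.sqrt t * t ^ e ≤ t ^ e' := by
    rw [Real.sqrt_eq_rpow, ← Real.rpow_add ht]
    exact hpow (by linarith)
  have h2 : t ^ (1 / 4 : ℝ) * (t ^ e) ^ (3 / 2 : ℝ) ≤ t ^ e' := by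
    rw [← Real.rpow_mul ht.le, ← Real.rpow_add ht]
    exact hpow (by linarith)
  have h3 : t * (t ^ e) ^ (1 / 2 : ℝ) ≤ t ^ e' := by
    rw [← Real.rpow_mul ht.le]
    conv_lhs => rw [show t * t ^ (e * (1 / 2)) = t ^ (1 : ℝ) * t ^ (e * (1 / 2)) by rw [Real.rpow_one]]
    rw [← Real.rpow_add ht]
    exact hpow (by linarith)
  -- the three terms
  have hE32 : E ^ (3 / 2 : ℝ) ≤ M ^ (3 / 2 : ℝ) * ENNReal.ofReal ((t ^ e) ^ (3 / 2 : ℝ)) := by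
    calc E ^ (3 / 2 : ℝ) ≤ (M * ENNReal.ofReal (t ^ e)) ^ (3 / 2 : ℝ) := ENNReal.rpow_le_rpow hE (by norm_num)
      _ = M ^ (3 / 2 : ℝ) * ENNReal.ofReal ((t ^ e) ^ (3 / 2 : ℝ)) := by
          rw [ENNReal.mul_rpow_of_nonneg _ _ (by norm_num), ENNReal.ofReal_rpow_of_nonneg hte (by norm_num)]
  have hE12 : E ^ (1 / 2 : ℝ) ≤ M ^ (1 / 2 : ℝ) * ENNReal.ofReal ((t ^ e) ^ (1 / 2 : ℝ)) := by
    calc E ^ (1 / 2 : ℝ) ≤ (M * ENNReal.ofReal (t ^ e)) ^ (1 / 2 : ℝ) := ENNReal.rpow_le_rpow hE (by norm_num)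
      _ = M ^ (1 / 2 : ℝ) * ENNReal.ofReal ((t ^ e) ^ (1 / 2 : ℝ)) := by
          rw [ENNReal.mul_rpow_of_nonneg _ _ (by norm_num), ENNReal.ofReal_rpow_of_nonneg hte (by norm_num)]
  have hT1 : P * ENNReal.ofReal (Real.sqrt t) * E ≤ P * M * ENNReal.ofReal (t ^ e') := by
    calc P * ENNReal.ofReal (Real.sqrt t) * E ≤ P * ENNReal.ofReal (Real.sqrt t) * (M * ENNReal.ofReal (t ^ e)) := by gcongr
      _ = P * M * (ENNReal.ofReal (Real.sqrt t) * ENNReal.ofReal (t ^ e)) := by ring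
      _ = P * M * ENNReal.ofReal (Real.sqrt t * t ^ e) := by rw [← ENNReal.ofReal_mul (Real.sqrt_nonneg _)]
      _ ≤ P * M * ENNReal.ofReal (t ^ e') := by gcongr
  have hT2 : ENNReal.ofReal (t ^ (1 / 4 : ℝ)) * E ^ (3 / 2 : ℝ) ≤ M ^ (3 / 2 : ℝ) * ENNReal.ofReal (t ^ e') := by
    calc ENNReal.ofReal (t ^ (1 / 4 : ℝ)) * E ^ (3 / 2 : ℝ)
        ≤ ENNReal.ofReal (t ^ (1 / 4 : ℝ)) * (M ^ (3 / 2 : ℝ) * ENNReal.ofReal ((t ^ e) ^ (3 / 2 : ℝ))) := by gcongr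
      _ = M ^ (3 / 2 : ℝ) * (ENNReal.ofReal (t ^ (1 / 4 : ℝ)) * ENNReal.ofReal ((t ^ e) ^ (3 / 2 : ℝ))) := by ring
      _ = M ^ (3 / 2 : ℝ) * ENNReal.ofReal (t ^ (1 / 4 : ℝ) * (t ^ e) ^ (3 / 2 : ℝ)) := by
          rw [← ENNReal.ofReal_mul (Real.rpow_nonneg ht.le _)]
      _ ≤ M ^ (3 / 2 : ℝ) * ENNReal.ofReal (t ^ e') := by gcongr
  have hT3 : Q * ENNReal.ofReal t * E ^ (1 / 2 : ℝ) ≤ Q * M ^ (1 / 2 : ℝ) * ENNReal.ofReal (t ^ e') := by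
    calc Q * ENNReal.ofReal t * E ^ (1 / 2 : ℝ)
        ≤ Q * ENNReal.ofReal t * (M ^ (1 / 2 : ℝ) * ENNReal.ofReal ((t ^ e) ^ (1 / 2 : ℝ))) := by gcongr
      _ = Q * M ^ (1 / 2 : ℝ) * (ENNReal.ofReal t * ENNReal.ofReal ((t ^ e) ^ (1 / 2 : ℝ))) := by ring
      _ = Q * M ^ (1 / 2 : ℝ) * ENNReal.ofReal (t * (t ^ e) ^ (1 / 2 : ℝ)) := by rw [← ENNReal.ofReal_mul ht.le]
      _ ≤ Q * M ^ (1 / 2 : ℝ) * ENNReal.ofReal (t ^ e') := by gcongr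
  calc C * (P * ENNReal.ofReal (Real.sqrt t) * E + ENNReal.ofReal (t ^ (1 / 4 : ℝ)) * E ^ (3 / 2 : ℝ) +
        Q * ENNReal.ofReal t * E ^ (1 / 2 : ℝ))
      ≤ C * (P * M * ENNReal.ofReal (t ^ e') + M ^ (3 / 2 : ℝ) * ENNReal.ofReal (t ^ e') +
          Q * M ^ (1 / 2 : ℝ) * ENNReal.ofReal (t ^ e')) := by gcongr
    _ = C * (P * M + M ^ (3 / 2 : ℝ) + Q * M ^ (1 / 2 : ℝ)) * ENNReal.ofReal (t ^ e') := by ring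

/-! ### Slice integrability of the energy density -/

/-- The slices `x ↦ |v(s,x)|² ψ(x)` of the energy density are integrable for a.e. `s ∈ (0,S)`
(Fubini on the strip). [folklore] -/
theorem ae_integrable_energy_slice {S : ℝ} {v : ℝ → (EuclideanSpace ℝ (Fin 3)) → (EuclideanSpace ℝ (Fin 3))} {ψ : (EuclideanSpace ℝ (Fin 3)) → ℝ}
    (hW : IntegrableOn (fun z : ℝ × (EuclideanSpace ℝ (Fin 3)) => ‖v z.1 z.2‖ ^ 2 * ψ z.2)
      (Ioo 0 S ×ˢ (univ : Set (EuclideanSpace ℝ (Fin 3)))) volume) :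
    ∀ᵐ s ∂(volume.restrict (Ioo 0 S)), Integrable (fun x => ‖v s x‖ ^ 2 * ψ x) volume := by
  have hW' : Integrable (fun z : ℝ × (EuclideanSpace ℝ (Fin 3)) => ‖v z.1 z.2‖ ^ 2 * ψ z.2)
      (((volume : Measure ℝ).restrict (Ioo 0 S)).prod (volume : Measure (EuclideanSpace ℝ (Fin 3)))) := by
    rw [Measure.restrict_prod_eq_prod_univ, ← Measure.volume_eq_prod]; exact hW
  exact hW'.prod_right_ae

/-- Finiteness is preserved by the step map `M ↦ C (P M + M^{3/2} + Q M^{1/2})`. [folklore] -/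
theorem step_ne_top {C P Q M : ℝ≥0∞} (hC : C ≠ ⊤) (hP : P ≠ ⊤) (hQ : Q ≠ ⊤) (hM : M ≠ ⊤) :
    C * (P * M + M ^ (3 / 2 : ℝ) + Q * M ^ (1 / 2 : ℝ)) ≠ ⊤ := by
  have h1 : M ^ (3 / 2 : ℝ) ≠ ⊤ := ENNReal.rpow_ne_top_of_nonneg (by norm_num) hM
  have h2 : M ^ (1 / 2 : ℝ) ≠ ⊤ := ENNReal.rpow_ne_top_of_nonneg (by norm_num) hM
  exact ENNReal.mul_ne_top hC (ENNReal.add_ne_top.2 ⟨ENNReal.add_ne_top.2 ⟨ENNReal.mul_ne_top hP hM, h1⟩, ENNReal.mul_ne_top hQ h2⟩)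

/-- The translate `x ↦ Ψ(x - y)` of a compactly supported function has compact support. [folklore] -/
theorem hasCompactSupport_translate {Ψ : (EuclideanSpace ℝ (Fin 3)) → ℝ} (hΨ : HasCompactSupport Ψ)
    (y : EuclideanSpace ℝ (Fin 3)) : HasCompactSupport fun x => Ψ (x - y) :=
  hΨ.comp_homeomorph (Homeomorph.subRight y)

/-! ### The iteration -/

set_option maxHeartbeats 3200000 in
/-- **The decay `E(t) ≲ t^{3/2}` of the local energy of the perturbation** (Jia–Šverák 2014,
proof of Thm. 3.1, arXiv p. 8, in the quantitative form needed for the standard ε-regularity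
criterion). For parameters `A > 0`, `C₁ ≥ 0`, `α²` (a bound of the uniformly local energy of
`v = u - a`) and `E₀` there is `Λ = Λ(A, C₁, α, E₀)` such that: for the data of `energy_step`
(centre `y` with `B_{3/4}(y)` inside the agreement ball `B_{ρ₀}(x₀)`) and `0 < t ≤ min(T', S₀, 1)`,
if `∫_{B_{3/4}(y)} |v(s)|² ≤ E₀` for a.e. `s ∈ (0,t)` and `∫∫_{(0,t)×B_{3/4}(y)} |G - Da|² ≤ E₀`, then
`∫_{B_{3/1024}(y)} |v(s)|² ≤ Λ t^{3/2}` for a.e. `s ∈ (0,t)` and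
`∫∫_{(0,t)×B_{3/1024}(y)} |G - Da|² ≤ Λ t^{3/2}` (four applications of `energy_step` on the balls
of radii `3/4, 3/16, 3/64, 3/256`, exponents `0 → 1/4 → 5/8 → 9/8 → 3/2`).
[cite: JiaSverak2014, §3 proof of Thm. 3.1 (arXiv p. 8)] -/
theorem decay_iteration (A C₁ : ℝ) (αv E₀ : ℝ≥0) :
    ∃ Λ : ℝ≥0, ∀ {T' S₀ S₂ : ℝ}
      {u₀ a₀ : (EuclideanSpace ℝ (Fin 3)) → (EuclideanSpace ℝ (Fin 3))} {u a : ℝ → (EuclideanSpace ℝ (Fin 3)) → (EuclideanSpace ℝ (Fin 3))}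
      {p π pK : ℝ → (EuclideanSpace ℝ (Fin 3)) → ℝ}
      {G : ℝ → (EuclideanSpace ℝ (Fin 3)) → (EuclideanSpace ℝ (Fin 3)) →L[ℝ] (EuclideanSpace ℝ (Fin 3))}
      {x₀ y : EuclideanSpace ℝ (Fin 3)} {ρ₀ t : ℝ},
      0 < T' → AEStronglyMeasurable u₀ volume → IsLocalLeraySolutionOn T' 1 u₀ u p →
      HasWeakSpatialGradientOn (slab (EuclideanSpace ℝ (Fin 3)) (Ioo 0 T') isOpen_Ioo) u G →
      (∀ R : ℝ, 0 < R → ∃ C : ℝ≥0, ∀ y' : (EuclideanSpace ℝ (Fin 3)),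
        ∫⁻ z in Ioo 0 T' ×ˢ ball y' R, ENNReal.ofReal (frobeniusNormSq (G z.1 z.2)) ≤ C) →
      0 < S₀ → S₀ ≤ S₂ → 0 < A → 0 ≤ C₁ →
      IsLocalLeraySolutionOn S₀ 1 a₀ a pK → IsClassicalNSSolutionOn (Ioo 0 S₂) 1 0 a π →
      (∀ t' ∈ Ioo 0 S₂, ∀ x, ‖a t' x‖ ≤ 2 * A) →
      (∀ t' ∈ Ioo 0 S₀, ∀ x, Real.sqrt t' * ‖fderiv ℝ (a t') x‖ ≤ C₁ * A) →
      0 < ρ₀ → (∀ x ∈ ball x₀ ρ₀, a₀ x = u₀ x) → ball y (3 / 4) ⊆ ball x₀ ρ₀ →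
      (∀ᵐ τ ∂(volume.restrict (Ioo 0 (min T' S₀))), ∀ z : EuclideanSpace ℝ (Fin 3),
        ∫⁻ x in ball z 1, ‖u τ x - a τ x‖ₑ ^ 2 ≤ αv) →
      0 < t → t ≤ min T' S₀ → t ≤ 1 →
      (∀ᵐ s ∂(volume.restrict (Ioo 0 t)), ∫⁻ x in ball y (3 / 4), ‖u s x - a s x‖ₑ ^ 2 ≤ E₀) →
      ∫⁻ z in Ioo 0 t ×ˢ ball y (3 / 4), ENNReal.ofReal (frobeniusNormSq (G z.1 z.2 - fderiv ℝ (a z.1) z.2)) ≤ E₀ →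
      (∀ᵐ s ∂(volume.restrict (Ioo 0 t)),
          ∫⁻ x in ball y (3 / 1024), ‖u s x - a s x‖ₑ ^ 2 ≤ Λ * ENNReal.ofReal (t ^ (3 / 2 : ℝ))) ∧
        ∫⁻ z in Ioo 0 t ×ˢ ball y (3 / 1024),
            ENNReal.ofReal (frobeniusNormSq (G z.1 z.2 - fderiv ℝ (a z.1) z.2)) ≤
          Λ * ENNReal.ofReal (t ^ (3 / 2 : ℝ)) := by
  -- ## the cut-offs and the step constants
  obtain ⟨Ψ₀, hΨ₀, hΨ₀0, -, hΨ₀s, hΨ₀1⟩ := exists_cutoff (r := 3 / 4) (by norm_num)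
  obtain ⟨Ψ₁, hΨ₁, hΨ₁0, -, hΨ₁s, hΨ₁1⟩ := exists_cutoff (r := 3 / 4 / 4) (by norm_num)
  obtain ⟨Ψ₂, hΨ₂, hΨ₂0, -, hΨ₂s, hΨ₂1⟩ := exists_cutoff (r := 3 / 4 / 4 / 4) (by norm_num)
  obtain ⟨Ψ₃, hΨ₃, hΨ₃0, -, hΨ₃s, hΨ₃1⟩ := exists_cutoff (r := 3 / 4 / 4 / 4 / 4) (by norm_num)
  obtain ⟨C₀, hC₀⟩ := energy_step (r := 3 / 4) (by norm_num) (by norm_num) hΨ₀ hΨ₀s hΨ₀0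
  obtain ⟨C₁', hC₁'⟩ := energy_step (r := 3 / 4 / 4) (by norm_num) (by norm_num) hΨ₁ hΨ₁s hΨ₁0
  obtain ⟨C₂, hC₂⟩ := energy_step (r := 3 / 4 / 4 / 4) (by norm_num) (by norm_num) hΨ₂ hΨ₂s hΨ₂0
  obtain ⟨C₃, hC₃⟩ := energy_step (r := 3 / 4 / 4 / 4 / 4) (by norm_num) (by norm_num) hΨ₃ hΨ₃s hΨ₃0
  have hΨ₀c : HasCompactSupport Ψ₀ := (isCompact_closedBall (0 : EuclideanSpace ℝ (Fin 3)) _).of_isClosed_subset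
    (isClosed_tsupport Ψ₀) (hΨ₀s.trans Metric.ball_subset_closedBall)
  have hΨ₁c : HasCompactSupport Ψ₁ := (isCompact_closedBall (0 : EuclideanSpace ℝ (Fin 3)) _).of_isClosed_subset
    (isClosed_tsupport Ψ₁) (hΨ₁s.trans Metric.ball_subset_closedBall)
  have hΨ₂c : HasCompactSupport Ψ₂ := (isCompact_closedBall (0 : EuclideanSpace ℝ (Fin 3)) _).of_isClosed_subset
    (isClosed_tsupport Ψ₂) (hΨ₂s.trans Metric.ball_subset_closedBall)
  have hΨ₃c : HasCompactSupport Ψ₃ := (isCompact_closedBall (0 : EuclideanSpace ℝ (Fin 3)) _).of_isClosed_subset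
    (isClosed_tsupport Ψ₃) (hΨ₃s.trans Metric.ball_subset_closedBall)
  -- ## the constants of the iteration
  set P : ℝ≥0∞ := 1 + ENNReal.ofReal A + ENNReal.ofReal (C₁ * A) with hP
  set Q : ℝ≥0∞ := ENNReal.ofReal A * (αv : ℝ≥0∞) ^ (1 / 2 : ℝ) + αv with hQ
  have hPt : P ≠ ⊤ := by simp only [hP]; finiteness
  have hQt : Q ≠ ⊤ := by
    simp only [hQ]
    have : (αv : ℝ≥0∞) ^ (1 / 2 : ℝ) ≠ ⊤ := ENNReal.rpow_ne_top_of_nonneg (by norm_num) ENNReal.coe_ne_top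
    finiteness
  set M₀ : ℝ≥0∞ := (E₀ : ℝ≥0∞) with hM₀
  set M₁ : ℝ≥0∞ := C₀ * (P * M₀ + M₀ ^ (3 / 2 : ℝ) + Q * M₀ ^ (1 / 2 : ℝ)) with hM₁
  set M₂ : ℝ≥0∞ := C₁' * (P * M₁ + M₁ ^ (3 / 2 : ℝ) + Q * M₁ ^ (1 / 2 : ℝ)) with hM₂
  set M₃ : ℝ≥0∞ := C₂ * (P * M₂ + M₂ ^ (3 / 2 : ℝ) + Q * M₂ ^ (1 / 2 : ℝ)) with hM₃
  set M₄ : ℝ≥0∞ := C₃ * (P * M₃ + M₃ ^ (3 / 2 : ℝ) + Q * M₃ ^ (1 / 2 : ℝ)) with hM₄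
  have hM₀t : M₀ ≠ ⊤ := ENNReal.coe_ne_top
  have hM₁t : M₁ ≠ ⊤ := step_ne_top ENNReal.coe_ne_top hPt hQt hM₀t
  have hM₂t : M₂ ≠ ⊤ := step_ne_top ENNReal.coe_ne_top hPt hQt hM₁t
  have hM₃t : M₃ ≠ ⊤ := step_ne_top ENNReal.coe_ne_top hPt hQt hM₂t
  have hM₄t : M₄ ≠ ⊤ := step_ne_top ENNReal.coe_ne_top hPt hQt hM₃t
  refine ⟨M₄.toNNReal, ?_⟩
  intro T' S₀ S₂ u₀ a₀ u a p π pK G x₀ y ρ₀ t hT' hm₀ hu hG hGb hS₀ hS₀₂ hA hC₁ hLK hcl hbd hgrad hρ₀ hagree hyr hαv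
    ht htS ht1 hE1 hE2
  rw [ENNReal.coe_toNNReal hM₄t]
  -- ## the generic step
  have hstep : ∀ {r : ℝ} {Ψ : (EuclideanSpace ℝ (Fin 3)) → ℝ} {Cst : ℝ≥0} {M : ℝ≥0∞} {e e' : ℝ},
      ContDiff ℝ (⊤ : ℕ∞) Ψ → HasCompactSupport Ψ → (∀ x, 0 ≤ Ψ x) → (∀ x ∈ ball (0 : EuclideanSpace ℝ (Fin 3)) (r / 4), Ψ x = 1) →
      ball y r ⊆ ball x₀ ρ₀ → M ≠ ⊤ →
      e' ≤ e + 1 / 2 → e' ≤ 1 / 4 + 3 / 2 * e → e' ≤ 1 + e / 2 →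
      (∀ {αv' Ek : ℝ≥0} {t'' : ℝ},
        (∀ᵐ τ ∂(volume.restrict (Ioo 0 (min T' S₀))), ∀ z : EuclideanSpace ℝ (Fin 3),
          ∫⁻ x in ball z 1, ‖u τ x - a τ x‖ₑ ^ 2 ≤ αv') →
        0 < t'' → t'' ≤ min T' S₀ → t'' ≤ 1 →
        (∀ᵐ s ∂(volume.restrict (Ioo 0 t'')), ∫⁻ x in ball y r, ‖u s x - a s x‖ₑ ^ 2 ≤ Ek) →
        ∫⁻ z in Ioo 0 t'' ×ˢ ball y r, ENNReal.ofReal (frobeniusNormSq (G z.1 z.2 - fderiv ℝ (a z.1) z.2)) ≤ Ek →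
        ∀ᵐ s ∂(volume.restrict (Ioo 0 t'')),
          ENNReal.ofReal (∫ x, ‖u s x - a s x‖ ^ 2 * Ψ (x - y)) +
              2 * ∫⁻ z in Ioo 0 s ×ˢ (univ : Set (EuclideanSpace ℝ (Fin 3))),
                ENNReal.ofReal (frobeniusNormSq (G z.1 z.2 - fderiv ℝ (a z.1) z.2) * Ψ (z.2 - y)) ≤
            Cst * ((1 + ENNReal.ofReal A + ENNReal.ofReal (C₁ * A)) * ENNReal.ofReal (Real.sqrt t'') * Ek +
              ENNReal.ofReal (t'' ^ (1 / 4 : ℝ)) * (Ek : ℝ≥0∞) ^ (3 / 2 : ℝ) +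
              (ENNReal.ofReal A * (αv' : ℝ≥0∞) ^ (1 / 2 : ℝ) + αv') * ENNReal.ofReal t'' * (Ek : ℝ≥0∞) ^ (1 / 2 : ℝ))) →
      (∀ᵐ s ∂(volume.restrict (Ioo 0 t)), ∫⁻ x in ball y r, ‖u s x - a s x‖ₑ ^ 2 ≤ M * ENNReal.ofReal (t ^ e)) →
      ∫⁻ z in Ioo 0 t ×ˢ ball y r, ENNReal.ofReal (frobeniusNormSq (G z.1 z.2 - fderiv ℝ (a z.1) z.2)) ≤ M * ENNReal.ofReal (t ^ e) →
      (∀ᵐ s ∂(volume.restrict (Ioo 0 t)), ∫⁻ x in ball y (r / 4), ‖u s x - a s x‖ₑ ^ 2 ≤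
          Cst * (P * M + M ^ (3 / 2 : ℝ) + Q * M ^ (1 / 2 : ℝ)) * ENNReal.ofReal (t ^ e')) ∧
        ∫⁻ z in Ioo 0 t ×ˢ ball y (r / 4), ENNReal.ofReal (frobeniusNormSq (G z.1 z.2 - fderiv ℝ (a z.1) z.2)) ≤
          Cst * (P * M + M ^ (3 / 2 : ℝ) + Q * M ^ (1 / 2 : ℝ)) * ENNReal.ofReal (t ^ e') := by
    intro r Ψ Cst M e e' hΨ hΨc hΨ0 hΨ1 hyr' hMt he1 he2 he3 hCst hE1' hE2'
    -- the energy level of this step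
    have hMEt : M * ENNReal.ofReal (t ^ e) ≠ ⊤ := ENNReal.mul_ne_top hMt ENNReal.ofReal_ne_top
    set Ek : ℝ≥0 := (M * ENNReal.ofReal (t ^ e)).toNNReal with hEkdef
    have hEk : (Ek : ℝ≥0∞) = M * ENNReal.ofReal (t ^ e) := ENNReal.coe_toNNReal hMEt
    have hE1'' : ∀ᵐ s ∂(volume.restrict (Ioo 0 t)), ∫⁻ x in ball y r, ‖u s x - a s x‖ₑ ^ 2 ≤ Ek := by
      rw [hEk]; exact hE1'
    have hE2'' : ∫⁻ z in Ioo 0 t ×ˢ ball y r, ENNReal.ofReal (frobeniusNormSq (G z.1 z.2 - fderiv ℝ (a z.1) z.2)) ≤ Ek := by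
      rw [hEk]; exact hE2'
    have htest := hCst hαv ht htS ht1 hE1'' hE2''
    -- the bound of the right-hand side
    have hbound : ∀ᵐ s ∂(volume.restrict (Ioo 0 t)),
        ENNReal.ofReal (∫ x, ‖u s x - a s x‖ ^ 2 * Ψ (x - y)) +
            2 * ∫⁻ z in Ioo 0 s ×ˢ (univ : Set (EuclideanSpace ℝ (Fin 3))),
              ENNReal.ofReal (frobeniusNormSq (G z.1 z.2 - fderiv ℝ (a z.1) z.2) * Ψ (z.2 - y)) ≤
          Cst * (P * M + M ^ (3 / 2 : ℝ) + Q * M ^ (1 / 2 : ℝ)) * ENNReal.ofReal (t ^ e') := by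
      filter_upwards [htest] with s hs
      exact hs.trans (iter_bound ht ht1 he1 he2 he3 (le_of_eq hEk))
    -- slice integrability of the energy density
    have hψ : ContDiff ℝ (⊤ : ℕ∞) fun x => Ψ (x - y) := hΨ.comp (contDiff_id.sub contDiff_const)
    obtain ⟨hWI, -, -, -, -⟩ := flux_pieces_integrableOn hT' hu hS₀ hS₀₂ hA hC₁ hLK hcl hbd hgrad hψ
      (hasCompactSupport_translate hΨc y)
    have hint : ∀ᵐ s ∂(volume.restrict (Ioo 0 t)), Integrable (fun x => ‖u s x - a s x‖ ^ 2 * Ψ (x - y)) volume :=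
      ae_restrict_of_ae_restrict_of_subset (Ioo_subset_Ioo_right htS)
        (ae_integrable_energy_slice (v := fun s x => u s x - a s x) hWI)
    exact ball_bounds_of_tested (v := fun s x => u s x - a s x)
      (d := fun z => frobeniusNormSq (G z.1 z.2 - fderiv ℝ (a z.1) z.2)) ht hΨ0 hΨ1 hint hbound
  -- ## the four steps
  have hyr₀ : ball y (3 / 4) ⊆ ball x₀ ρ₀ := hyr
  have hyr₁ : ball y (3 / 4 / 4) ⊆ ball x₀ ρ₀ := (ball_subset_ball (by norm_num)).trans hyr
  have hyr₂ : ball y (3 / 4 / 4 / 4) ⊆ ball x₀ ρ₀ := (ball_subset_ball (by norm_num)).trans hyr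
  have hyr₃ : ball y (3 / 4 / 4 / 4 / 4) ⊆ ball x₀ ρ₀ := (ball_subset_ball (by norm_num)).trans hyr
  -- step 0: `e = 0 → 1/4`
  have hE1₀ : ∀ᵐ s ∂(volume.restrict (Ioo 0 t)), ∫⁻ x in ball y (3 / 4), ‖u s x - a s x‖ₑ ^ 2 ≤ M₀ * ENNReal.ofReal (t ^ (0 : ℝ)) := by
    rw [Real.rpow_zero, ENNReal.ofReal_one, mul_one]; exact hE1
  have hE2₀ : ∫⁻ z in Ioo 0 t ×ˢ ball y (3 / 4), ENNReal.ofReal (frobeniusNormSq (G z.1 z.2 - fderiv ℝ (a z.1) z.2)) ≤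
      M₀ * ENNReal.ofReal (t ^ (0 : ℝ)) := by
    rw [Real.rpow_zero, ENNReal.ofReal_one, mul_one]; exact hE2
  obtain ⟨hE1₁, hE2₁⟩ := hstep (e := 0) (e' := 1 / 4) hΨ₀ hΨ₀c hΨ₀0 hΨ₀1 hyr₀ hM₀t (by norm_num) (by norm_num) (by norm_num)
    (fun hαv' ht' htS' ht1' hE1' hE2' => hC₀ hT' hm₀ hu hG hGb hS₀ hS₀₂ hA hC₁ hLK hcl hbd hgrad hρ₀ hagree hyr₀ hαv' ht' htS' ht1' hE1' hE2')
    hE1₀ hE2₀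
  -- step 1: `1/4 → 5/8`
  obtain ⟨hE1₂, hE2₂⟩ := hstep (e := 1 / 4) (e' := 5 / 8) hΨ₁ hΨ₁c hΨ₁0 hΨ₁1 hyr₁ hM₁t (by norm_num) (by norm_num) (by norm_num)
    (fun hαv' ht' htS' ht1' hE1' hE2' => hC₁' hT' hm₀ hu hG hGb hS₀ hS₀₂ hA hC₁ hLK hcl hbd hgrad hρ₀ hagree hyr₁ hαv' ht' htS' ht1' hE1' hE2')
    hE1₁ hE2₁
  -- step 2: `5/8 → 9/8`
  obtain ⟨hE1₃, hE2₃⟩ := hstep (e := 5 / 8) (e' := 9 / 8) hΨ₂ hΨ₂c hΨ₂0 hΨ₂1 hyr₂ hM₂t (by norm_num) (by norm_num) (by norm_num)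
    (fun hαv' ht' htS' ht1' hE1' hE2' => hC₂ hT' hm₀ hu hG hGb hS₀ hS₀₂ hA hC₁ hLK hcl hbd hgrad hρ₀ hagree hyr₂ hαv' ht' htS' ht1' hE1' hE2')
    hE1₂ hE2₂
  -- step 3: `9/8 → 3/2`
  obtain ⟨hE1₄, hE2₄⟩ := hstep (e := 9 / 8) (e' := 3 / 2) hΨ₃ hΨ₃c hΨ₃0 hΨ₃1 hyr₃ hM₃t (by norm_num) (by norm_num) (by norm_num)
    (fun hαv' ht' htS' ht1' hE1' hE2' => hC₃ hT' hm₀ hu hG hGb hS₀ hS₀₂ hA hC₁ hLK hcl hbd hgrad hρ₀ hagree hyr₃ hαv' ht' htS' ht1' hE1' hE2')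
    hE1₃ hE2₃
  have hr₄ : (3 / 4 / 4 / 4 / 4 / 4 : ℝ) = 3 / 1024 := by norm_num
  rw [hr₄] at hE1₄ hE2₄
  exact ⟨hE1₄, hE2₄⟩

end JiaSverak2014

end Literature.Analysis.FluidPDE

end
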